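import Mathlib
import Summits.KontsevichZagierPeriods.KontsevichZagierPeriods.Theorems.ScissorsTransportPolytopeTransportLinAffine
import Summits.KontsevichZagierPeriods.KontsevichZagierPeriods.Theorems.ScissorsTransportPolytopeTransportCells

/-!
# Polytope transport — linear cylindrical decomposition of a box

Helper file for `PolytopeTransport` (stmt-KontsevichZagierPeriods-10815, route ScissorsTransport).
**Main result** (`linCAD`): for a finite family `F` of rational affine functions on `ℝⁿ` and a
rational `R`, the box `(-R, R)ⁿ` is, up to a null set, the disjoint union of finitely many
well-formed cylindrical cells with rational affine bounds (`CellData`) on each of which every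
`f ∈ F` has constant sign. Proof: the linear case of Collins' cylindrical algebraic decomposition —
project away `x₀`, decompose `ℝⁿ⁻¹` adapted to the pairwise differences of the root functions
(and the walls `±R`), and slice each cylinder by the consecutive root functions, which are totally
ordered over each base cell. Folklore (Bochnak–Coste–Roy 1998, §2.3, linear case).
-/

noncomputable section

open Set MvPolynomial MeasureTheory
open scoped BigOperators

namespace Summit.KontsevichZagierPeriods.ScissorsTransport.PolytopeTransport

namespace LinCAD

variable {n : ℕ}

/-! ### The projected families -/

/-- Root functions of the members of `F` with non-zero leading coefficient, together with the
walls `±R`. [folklore] -/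
def roots (F : Finset (LinQ (n + 1))) (R : ℚ) : Finset (LinQ n) :=
  (F.filter (fun f => f.lead ≠ 0)).image LinQ.root ∪ {LinQ.const n (-R), LinQ.const n R}

/-- The family one dimension down: flats of the members without `x₀`, and all pairwise
differences of root functions. [folklore] -/
def derived (F : Finset (LinQ (n + 1))) (R : ℚ) : Finset (LinQ n) :=
  (F.filter (fun f => f.lead = 0)).image LinQ.flat ∪
    ((roots F R) ×ˢ (roots F R)).image (fun p => p.1 - p.2)

variable {F : Finset (LinQ (n + 1))} {R : ℚ}

/-- The wall `-R` is among the root functions. [folklore] -/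
theorem const_neg_mem_roots : LinQ.const n (-R) ∈ roots F R := by
  simp [roots]

/-- The wall `R` is among the root functions. [folklore] -/
theorem const_mem_roots : LinQ.const n R ∈ roots F R := by
  simp [roots]

/-- Root functions of members of `F` with `lead ≠ 0` are among the root functions. [folklore] -/
theorem root_mem_roots {f : LinQ (n + 1)} (hf : f ∈ F) (h : f.lead ≠ 0) : f.root ∈ roots F R := by
  simp only [roots, Finset.mem_union, Finset.mem_image, Finset.mem_filter]
  exact Or.inl ⟨f, ⟨hf, h⟩, rfl⟩

/-- Differences of root functions belong to the derived family. [folklore] -/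
theorem sub_mem_derived {r s : LinQ n} (hr : r ∈ roots F R) (hs : s ∈ roots F R) :
    r - s ∈ derived F R := by
  simp only [derived, Finset.mem_union, Finset.mem_image, Finset.mem_product]
  exact Or.inr ⟨(r, s), ⟨hr, hs⟩, rfl⟩

/-- Flats of members of `F` without `x₀` belong to the derived family. [folklore] -/
theorem flat_mem_derived {f : LinQ (n + 1)} (hf : f ∈ F) (h : f.lead = 0) : f.flat ∈ derived F R := by
  simp only [derived, Finset.mem_union, Finset.mem_image, Finset.mem_filter]
  exact Or.inl ⟨f, ⟨hf, h⟩, rfl⟩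

/-! ### Slicing one cylinder -/

section Slice

variable (F R)

/-- Values of the root functions at the base point `y₀`. [folklore] -/
def vals (y₀ : Fin n → ℝ) : Finset ℝ := (roots F R).image (fun r => r.ev y₀)

/-- Values in `[-R, R)`: the lower ends of the bands. [folklore] -/
def low (y₀ : Fin n → ℝ) : Finset ℝ := (vals F R y₀).filter (fun v => -(R : ℝ) ≤ v ∧ v < R)

/-- The next value above `v` (junk value `R` if there is none). [folklore] -/
def nxt (y₀ : Fin n → ℝ) (v : ℝ) : ℝ :=
  if h : ((vals F R y₀).filter (fun u => v < u)).Nonempty then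
    ((vals F R y₀).filter (fun u => v < u)).min' h else R

/-- A root function taking the value `v` at `y₀` (junk value `0` if there is none). [folklore] -/
def rep (y₀ : Fin n → ℝ) (v : ℝ) : LinQ n :=
  if h : ∃ r ∈ roots F R, r.ev y₀ = v then h.choose else 0

/-- The band between the root functions representing `v` and `nxt v`, over the cell `c`.
[folklore] -/
def band (y₀ : Fin n → ℝ) (c : CellData n) (v : ℝ) : CellData (n + 1) :=
  CellData.cons (rep F R y₀ v).toPoly (rep F R y₀ (nxt F R y₀ v)).toPoly c

variable {F R}
variable {y₀ : Fin n → ℝ}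

/-- Unfolding of `vals`. [folklore] -/
theorem mem_vals {v : ℝ} : v ∈ vals F R y₀ ↔ ∃ r ∈ roots F R, r.ev y₀ = v := by
  simp [vals]

/-- Values of root functions at `y₀` are values. [folklore] -/
theorem ev_mem_vals {r : LinQ n} (hr : r ∈ roots F R) : r.ev y₀ ∈ vals F R y₀ :=
  mem_vals.2 ⟨r, hr, rfl⟩

/-- `R` is a value (of the wall `R`). [folklore] -/
theorem R_mem_vals : (R : ℝ) ∈ vals F R y₀ := by
  have := ev_mem_vals (y₀ := y₀) (const_mem_roots (F := F) (R := R))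
  simpa using this

/-- Unfolding of `low`. [folklore] -/
theorem mem_low {v : ℝ} : v ∈ low F R y₀ ↔ v ∈ vals F R y₀ ∧ -(R : ℝ) ≤ v ∧ v < R := by
  simp [low]

/-- `rep v` is a root function with value `v` at `y₀`. [folklore] -/
theorem rep_spec {v : ℝ} (hv : v ∈ vals F R y₀) :
    rep F R y₀ v ∈ roots F R ∧ (rep F R y₀ v).ev y₀ = v := by
  have h : ∃ r ∈ roots F R, r.ev y₀ = v := mem_vals.1 hv
  rw [rep, dif_pos h]
  exact h.choose_spec

/-- `nxt v` is the least value above `v` (for `v < R`). [folklore] -/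
theorem nxt_spec {v : ℝ} (hv : v < R) :
    nxt F R y₀ v ∈ vals F R y₀ ∧ v < nxt F R y₀ v ∧ ∀ u ∈ vals F R y₀, v < u → nxt F R y₀ v ≤ u := by
  have hT : ((vals F R y₀).filter (fun u => v < u)).Nonempty :=
    ⟨R, Finset.mem_filter.2 ⟨R_mem_vals, hv⟩⟩
  rw [nxt, dif_pos hT]
  have hmem := Finset.min'_mem _ hT
  rw [Finset.mem_filter] at hmem
  exact ⟨hmem.1, hmem.2, fun u hu hvu => Finset.min'_le _ u (Finset.mem_filter.2 ⟨hu, hvu⟩)⟩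

/-- `nxt v ≤ R` for `v < R`. [folklore] -/
theorem nxt_le_R {v : ℝ} (hv : v < R) : nxt F R y₀ v ≤ R :=
  (nxt_spec hv).2.2 _ R_mem_vals hv

/-- Membership in a band. [folklore] -/
theorem mem_band_set {c : CellData n} {v : ℝ} {x : Fin (n + 1) → ℝ} :
    x ∈ (band F R y₀ c v).set ↔ Fin.tail x ∈ c.set ∧ (rep F R y₀ v).ev (Fin.tail x) < x 0 ∧
      x 0 < (rep F R y₀ (nxt F R y₀ v)).ev (Fin.tail x) := by
  simp [band, CellData.mem_set_cons]

/-! Transfer of the order of root functions along a base set `C ∋ y₀` on which all members of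
`derived F R` have constant sign. -/

variable {C : Set (Fin n → ℝ)}

/-- Transfer of `<` between root functions along `C`. [folklore] -/
theorem lt_on (hK : ∀ g ∈ derived F R, C ∈ g.signSets) {r s : LinQ n} (hr : r ∈ roots F R)
    (hs : s ∈ roots F R) {y : Fin n → ℝ} (hy : y ∈ C) (h : r.ev y < s.ev y) :
    ∀ x ∈ C, r.ev x < s.ev x :=
  SignConst.lt_of_lt (hK _ (sub_mem_derived hr hs)) hy h

/-- Transfer of `≤` between root functions along `C`. [folklore] -/
theorem le_on (hK : ∀ g ∈ derived F R, C ∈ g.signSets) {r s : LinQ n} (hr : r ∈ roots F R)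
    (hs : s ∈ roots F R) {y : Fin n → ℝ} (hy : y ∈ C) (h : r.ev y ≤ s.ev y) :
    ∀ x ∈ C, r.ev x ≤ s.ev x :=
  SignConst.le_of_le (hK _ (sub_mem_derived hr hs)) hy h

/-- Transfer of `=` between root functions along `C`. [folklore] -/
theorem eq_on (hK : ∀ g ∈ derived F R, C ∈ g.signSets) {r s : LinQ n} (hr : r ∈ roots F R)
    (hs : s ∈ roots F R) {y : Fin n → ℝ} (hy : y ∈ C) (h : r.ev y = s.ev y) :
    ∀ x ∈ C, r.ev x = s.ev x :=
  SignConst.eq_of_eq (hK _ (sub_mem_derived hr hs)) hy h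

variable {c : CellData n} (hK : ∀ g ∈ derived F R, c.set ∈ g.signSets) (hy₀ : y₀ ∈ c.set)
include hK hy₀

/-- Bands are well-formed. [folklore] -/
theorem band_WF (hc : c ∈ CellData.wfSet n) {v : ℝ} (hv : v ∈ low F R y₀) :
    band F R y₀ c v ∈ CellData.wfSet (n + 1) := by
  obtain ⟨hvv, -, hvR⟩ := mem_low.1 hv
  obtain ⟨hr, hrv⟩ := rep_spec hvv
  obtain ⟨hnv, hvn, -⟩ := nxt_spec (y₀ := y₀) (F := F) hvR
  obtain ⟨hs, hsv⟩ := rep_spec hnv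
  refine CellData.cons_mem_wfSet.2 ⟨hc, fun y hy => ?_⟩
  simp only [LinQ.aeval_toPoly]
  exact lt_on hK hr hs hy₀ (by rw [hrv, hsv]; exact hvn) y hy

/-- Bands lie in the box. [folklore] -/
theorem band_subset_cbox (hcR : c.set ⊆ cbox n R) {v : ℝ} (hv : v ∈ low F R y₀) :
    (band F R y₀ c v).set ⊆ cbox (n + 1) R := by
  obtain ⟨hvv, hRv, hvR⟩ := mem_low.1 hv
  obtain ⟨hr, hrv⟩ := rep_spec hvv
  obtain ⟨hnv, -, -⟩ := nxt_spec (y₀ := y₀) (F := F) hvR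
  obtain ⟨hs, hsv⟩ := rep_spec hnv
  intro x hx
  rw [mem_band_set] at hx
  obtain ⟨ht, h1, h2⟩ := hx
  rw [mem_cbox_succ]
  refine ⟨⟨?_, ?_⟩, hcR ht⟩
  · have := le_on hK const_neg_mem_roots hr hy₀ (by rw [hrv]; simpa using hRv) _ ht
    simp only [LinQ.ev_const, Rat.cast_neg] at this
    linarith
  · have := le_on hK hs const_mem_roots hy₀ (by rw [hsv, LinQ.ev_const]; exact nxt_le_R hvR) _ ht
    simp only [LinQ.ev_const] at this
    linarith

/-- Distinct bands over the same cell are disjoint (ordered case). [folklore] -/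
theorem band_disjoint_of_lt {v v' : ℝ} (hv : v ∈ low F R y₀) (hv' : v' ∈ low F R y₀) (hlt : v < v') :
    Disjoint (band F R y₀ c v).set (band F R y₀ c v').set := by
  obtain ⟨hvv, -, hvR⟩ := mem_low.1 hv
  obtain ⟨hvv', -, -⟩ := mem_low.1 hv'
  obtain ⟨hnv, -, hmin⟩ := nxt_spec (y₀ := y₀) (F := F) hvR
  obtain ⟨hs, hsv⟩ := rep_spec hnv
  obtain ⟨hr', hrv'⟩ := rep_spec hvv'
  have hle : nxt F R y₀ v ≤ v' := hmin _ hvv' hlt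
  rw [disjoint_left]
  intro x hx hx'
  rw [mem_band_set] at hx hx'
  have := le_on hK hs hr' hy₀ (by rw [hsv, hrv']; exact hle) _ hx.1
  linarith [hx.2.2, hx'.2.1]

/-- Distinct bands over the same cell are disjoint. [folklore] -/
theorem band_disjoint {v v' : ℝ} (hv : v ∈ low F R y₀) (hv' : v' ∈ low F R y₀) (hne : v ≠ v') :
    Disjoint (band F R y₀ c v).set (band F R y₀ c v').set := by
  rcases hne.lt_or_gt with h | h
  · exact band_disjoint_of_lt hK hy₀ hv hv' h
  · exact (band_disjoint_of_lt hK hy₀ hv' hv h).symm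

/-- Every `f ∈ F` has constant sign on each band. [folklore] -/
theorem signConst_band {f : LinQ (n + 1)} (hf : f ∈ F) {v : ℝ} (hv : v ∈ low F R y₀) :
    (band F R y₀ c v).set ∈ f.signSets := by
  obtain ⟨hvv, -, hvR⟩ := mem_low.1 hv
  obtain ⟨hr, hrv⟩ := rep_spec hvv
  obtain ⟨hnv, hvn, hmin⟩ := nxt_spec (y₀ := y₀) (F := F) hvR
  obtain ⟨hs, hsv⟩ := rep_spec hnv
  by_cases hlead : f.lead = 0
  · -- no `x₀`: transfer from the base cell
    rcases hK _ (flat_mem_derived hf hlead) with h | h | h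
    · exact Or.inl fun x hx => by
        rw [LinQ.ev_of_lead_eq_zero f hlead]; exact h _ (mem_band_set.1 hx).1
    · exact Or.inr (Or.inl fun x hx => by
        rw [LinQ.ev_of_lead_eq_zero f hlead]; exact h _ (mem_band_set.1 hx).1)
    · exact Or.inr (Or.inr fun x hx => by
        rw [LinQ.ev_of_lead_eq_zero f hlead]; exact h _ (mem_band_set.1 hx).1)
  · have hρ : f.root ∈ roots F R := root_mem_roots hf hlead
    set u := f.root.ev y₀ with hu
    -- the root function is below the band or above it, everywhere over the cell
    have hside : (∀ x ∈ (band F R y₀ c v).set, 0 < x 0 - f.root.ev (Fin.tail x)) ∨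
        (∀ x ∈ (band F R y₀ c v).set, x 0 - f.root.ev (Fin.tail x) < 0) := by
      rcases le_or_gt u v with huv | huv
      · left
        intro x hx
        rw [mem_band_set] at hx
        have := le_on hK hρ hr hy₀ (by rw [hrv]; exact huv) _ hx.1
        linarith [hx.2.1]
      · right
        have hun : nxt F R y₀ v ≤ u := hmin u (ev_mem_vals hρ) huv
        intro x hx
        rw [mem_band_set] at hx
        have := le_on hK hs hρ hy₀ (by rw [hsv]; exact hun) _ hx.1
        linarith [hx.2.2]
    have hlead' : (0 : ℝ) < f.lead ∨ (f.lead : ℝ) < 0 := by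
      rcases lt_trichotomy (f.lead : ℝ) 0 with h | h | h
      · exact Or.inr h
      · exact absurd (by exact_mod_cast h) hlead
      · exact Or.inl h
    rcases hside with hpos | hneg <;> rcases hlead' with hl | hl
    · exact Or.inl fun x hx => by
        rw [LinQ.ev_eq_lead_mul_sub_root f hlead]; exact mul_pos hl (hpos x hx)
    · exact Or.inr (Or.inl fun x hx => by
        rw [LinQ.ev_eq_lead_mul_sub_root f hlead]; exact mul_neg_of_neg_of_pos hl (hpos x hx))
    · exact Or.inr (Or.inl fun x hx => by
        rw [LinQ.ev_eq_lead_mul_sub_root f hlead]; exact mul_neg_of_pos_of_neg hl (hneg x hx))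
    · exact Or.inl fun x hx => by
        rw [LinQ.ev_eq_lead_mul_sub_root f hlead]; exact mul_pos_of_neg_of_neg hl (hneg x hx)

/-- Every point of the cylinder off the root hyperplanes lies in some band. [folklore] -/
theorem exists_mem_band {x : Fin (n + 1) → ℝ} (hx : x ∈ cbox (n + 1) R) (ht : Fin.tail x ∈ c.set)
    (hroot : ∀ r ∈ roots F R, x 0 ≠ r.ev (Fin.tail x)) :
    ∃ v ∈ low F R y₀, x ∈ (band F R y₀ c v).set := by
  classical
  rw [mem_cbox_succ] at hx
  -- the root functions below `x₀` at `tail x`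
  set S₀ := (roots F R).filter (fun r => r.ev (Fin.tail x) < x 0) with hS₀
  have hS₀ne : S₀.Nonempty := ⟨LinQ.const n (-R), Finset.mem_filter.2 ⟨const_neg_mem_roots, by
    simpa using hx.1.1⟩⟩
  obtain ⟨r₀, hr₀S, hmax⟩ := Finset.exists_max_image S₀ (fun r => r.ev y₀) hS₀ne
  obtain ⟨hr₀, hr₀x⟩ := Finset.mem_filter.1 hr₀S
  set v := r₀.ev y₀ with hv_def
  have hvv : v ∈ vals F R y₀ := ev_mem_vals hr₀
  have hRv : -(R : ℝ) ≤ v := by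
    have := hmax _ (Finset.mem_filter.2 ⟨const_neg_mem_roots, by simpa using hx.1.1⟩)
    simpa using this
  have hvR : v < R := by
    have := lt_on hK hr₀ const_mem_roots ht (by simpa using hr₀x.trans hx.1.2) y₀ hy₀
    simpa using this
  have hv : v ∈ low F R y₀ := mem_low.2 ⟨hvv, hRv, hvR⟩
  refine ⟨v, hv, ?_⟩
  obtain ⟨hr, hrv⟩ := rep_spec hvv
  obtain ⟨hnv, hvn, -⟩ := nxt_spec (y₀ := y₀) (F := F) hvR
  obtain ⟨hs, hsv⟩ := rep_spec hnv
  rw [mem_band_set]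
  refine ⟨ht, ?_, ?_⟩
  · rw [eq_on hK hr hr₀ hy₀ (by rw [hrv]) _ ht]
    exact hr₀x
  · rcases lt_trichotomy (x 0) ((rep F R y₀ (nxt F R y₀ v)).ev (Fin.tail x)) with h | h | h
    · exact h
    · exact absurd h (hroot _ hs)
    · have hmem : rep F R y₀ (nxt F R y₀ v) ∈ S₀ := Finset.mem_filter.2 ⟨hs, h⟩
      have := hmax _ hmem
      rw [hsv] at this
      exact absurd this (not_le.2 hvn)

end Slice

/-! ### Assembly: the induction on the dimension -/

/-- A base point of a well-formed cell. [folklore] -/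
def basePt (c : CellData n) (h : c ∈ CellData.wfSet n) : Fin n → ℝ := (CellData.nonempty_set c h).some

/-- The base point lies in the cell. [folklore] -/
theorem basePt_mem (c : CellData n) (h : c ∈ CellData.wfSet n) : basePt c h ∈ c.set :=
  (CellData.nonempty_set c h).some_mem

/-- **Induction step**: from a decomposition of `(-R, R)ⁿ` adapted to `derived F R` to a
decomposition of `(-R, R)ⁿ⁺¹` adapted to `F`. [folklore] -/
theorem step (F : Finset (LinQ (n + 1))) (R : ℚ) {ι' : Type} [Fintype ι'] (cell' : ι' → CellData n)
    (hwf : ∀ i, cell' i ∈ CellData.wfSet n) (hsub : ∀ i, (cell' i).set ⊆ cbox n R)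
    (hdisj : Pairwise fun i j => Disjoint (cell' i).set (cell' j).set)
    (hsign : ∀ i, ∀ g ∈ derived F R, (cell' i).set ∈ g.signSets)
    (hcov : volume (cbox n R \ ⋃ i, (cell' i).set) = 0) :
    ∃ (ι : Type) (_ : Fintype ι) (cell : ι → CellData (n + 1)),
      (∀ i, cell i ∈ CellData.wfSet (n + 1)) ∧ (∀ i, (cell i).set ⊆ cbox (n + 1) R) ∧
      (Pairwise fun i j => Disjoint (cell i).set (cell j).set) ∧
      (∀ i, ∀ f ∈ F, (cell i).set ∈ f.signSets) ∧ volume (cbox (n + 1) R \ ⋃ i, (cell i).set) = 0 := by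
  classical
  set y₀ : ι' → (Fin n → ℝ) := fun i => basePt (cell' i) (hwf i) with hy₀_def
  have hy₀ : ∀ i, y₀ i ∈ (cell' i).set := fun i => basePt_mem _ _
  set J : ι' → Finset ℝ := fun i => low F R (y₀ i) with hJ_def
  refine ⟨Σ i : ι', (J i : Set ℝ), inferInstance, fun p => band F R (y₀ p.1) (cell' p.1) p.2.1,
    ?_, ?_, ?_, ?_, ?_⟩
  · intro p
    exact band_WF (hsign p.1) (hy₀ p.1) (hwf p.1) (Finset.mem_coe.1 p.2.2)
  · intro p
    exact band_subset_cbox (hsign p.1) (hy₀ p.1) (hsub p.1) (Finset.mem_coe.1 p.2.2)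
  · rintro ⟨i, v, hv⟩ ⟨j, w, hw⟩ hne
    by_cases hij : i = j
    · subst hij
      have hvw : v ≠ w := by
        intro h
        subst h
        exact hne rfl
      exact band_disjoint (hsign i) (hy₀ i) (Finset.mem_coe.1 hv) (Finset.mem_coe.1 hw) hvw
    · rw [disjoint_left]
      intro x hx hx'
      exact disjoint_left.1 (hdisj hij) (mem_band_set.1 hx).1 (mem_band_set.1 hx').1
  · intro p f hf
    exact signConst_band (hsign p.1) (hy₀ p.1) hf (Finset.mem_coe.1 p.2.2)
  · have hcover : cbox (n + 1) R \ ⋃ p : (Σ i : ι', (J i : Set ℝ)),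
        (band F R (y₀ p.1) (cell' p.1) p.2.1).set ⊆
        {x | Fin.tail x ∈ cbox n R \ ⋃ i, (cell' i).set} ∪
          ⋃ r ∈ roots F R, {x : Fin (n + 1) → ℝ | x 0 = r.ev (Fin.tail x)} := by
      intro x hx
      by_cases h1 : Fin.tail x ∈ ⋃ i, (cell' i).set
      · by_cases h2 : ∃ r ∈ roots F R, x 0 = r.ev (Fin.tail x)
        · right
          obtain ⟨r, hr, hxr⟩ := h2
          exact mem_biUnion hr hxr
        · exfalso
          push Not at h2
          obtain ⟨i, hi⟩ := mem_iUnion.1 h1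
          obtain ⟨v, hv, hxv⟩ := exists_mem_band (hsign i) (hy₀ i) hx.1 hi h2
          exact hx.2 (mem_iUnion.2 ⟨⟨i, v, Finset.mem_coe.2 hv⟩, hxv⟩)
      · left
        exact ⟨(mem_cbox_succ.1 hx.1).2, h1⟩
    refine measure_mono_null hcover (measure_union_null (volume_setOf_tail_mem_null hcov) ?_)
    refine (measure_biUnion_null_iff (roots F R).countable_toSet).2 fun r _ => ?_
    exact volume_setOf_eq_tail_null (LinQ.continuous_ev r)

/-- **Linear cylindrical decomposition.** For a finite family `F` of rational affine functions on
`ℝⁿ` and `R ∈ ℚ`, the box `(-R, R)ⁿ` is, up to a null set, a finite disjoint union of well-formed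
cylindrical cells with rational affine bounds on each of which every `f ∈ F` has constant sign.
[folklore] -/
theorem linCAD : ∀ (n : ℕ) (F : Finset (LinQ n)) (R : ℚ),
    ∃ (ι : Type) (_ : Fintype ι) (cell : ι → CellData n),
      (∀ i, cell i ∈ CellData.wfSet n) ∧ (∀ i, (cell i).set ⊆ cbox n R) ∧
      (Pairwise fun i j => Disjoint (cell i).set (cell j).set) ∧
      (∀ i, ∀ f ∈ F, (cell i).set ∈ f.signSets) ∧ volume (cbox n R \ ⋃ i, (cell i).set) = 0
  | 0, F, R => by
    refine ⟨Unit, inferInstance, fun _ => CellData.nil, fun _ => CellData.nil_mem_wfSet, fun _ => by simp,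
      Subsingleton.pairwise, ?_, by simp [Set.iUnion_const]⟩
    intro _ f _
    rcases lt_trichotomy (f.2 : ℝ) 0 with h | h | h
    · exact Or.inr (Or.inl fun x _ => by simpa [LinQ.ev] using h)
    · exact Or.inr (Or.inr fun x _ => by simpa [LinQ.ev] using h)
    · exact Or.inl fun x _ => by simpa [LinQ.ev] using h
  | n + 1, F, R => by
    obtain ⟨ι', hι', cell', hwf, hsub, hdisj, hsign, hcov⟩ := linCAD n (derived F R) R
    exact step F R cell' hwf hsub hdisj hsign hcov

end LinCAD

end Summit.KontsevichZagierPeriods.ScissorsTransport.PolytopeTransport
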